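import Literature.Analysis.FluidPDE.PlanarLiftWeak
import Literature.Analysis.FluidPDE.KNSSLiouvillePlanar
import Literature.Analysis.FluidPDE.KNSSRegularityGluing
import HarnessLib

/-!
# KNSS 2009, §4: the planar ancient regularity fact from the spatial one

Analysis/FluidPDE proofs file (theorems and two auxiliary definitions) on the discharge path of
the named fact `Literature.Analysis.FluidPDE.KNSS2009_regularity_boundedWeak_ancient_planar`
(`KNSSRegularityPlanar`): the regularity theory of Koch–Nadirashvili–Seregin–Šverák, Acta Math.
203 (2009) = arXiv:0709.3599, §4 (Lemma 3.1, the linear estimates (3.10)–(3.14),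
Proposition 4.1, Serrin's bootstrap, closing bounds (4.10)–(4.11)) for bounded weak solutions of
Navier–Stokes on `ℝ² × (−∞, 0)`, the input "By the results of Section 4" of the proof of
Theorem 5.1 (p. 9). KNSS write §4 once for `u : ℝⁿ × (0, T) → ℝⁿ`; the tree vendors its ancient
form for `n = 3` (`KNSS2009_regularity_boundedWeak_ancient`, `KNSSRegularity`, itself reduced in
the tree to the printed window statement and further to Lemma 3.1 + Galilean covariance +
smoothing of bounded mild solutions: `KNSSRegularityWindow`, `KNSSRegularityAncient`,
`KNSSRegularityDecomposition`, `KNSSRegularityGalilean`) and for `n = 2` (the planar fact). Main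
result of this file:

* `KNSS2009_regularity_boundedWeak_ancient_planar_of_ancient :
    KNSS2009_regularity_boundedWeak_ancient → KNSS2009_regularity_boundedWeak_ancient_planar`;
* corollary `KNSS2009_liouville_planar_of_ancient`: with the tree's
  `KNSS2009_liouville_planar_of_regularity` (`KNSSLiouvillePlanar`), Theorem 5.1 as printed
  (`KNSS2009_liouville_planar`) follows from the spatial §4 fact alone, the same trust base as
  the tree's Theorems 5.2–5.3.

So the planar fact is discharged the day the spatial one is, and no planar copy of the
Oseen-kernel machinery of the `n = 3` programme is needed.

## The proof

Given a bounded weak solution `u` on `ℝ² × (−∞, 0)`, its planar lift `ũ(t, x) = (u(t, x₀, x₁), 0)`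
is a bounded weak solution on `ℝ³ × (−∞, 0)` (`IsBoundedWeakNSSolutionOn.planarLift`,
`PlanarLiftWeak`). The spatial fact gives `ũ(t) = Ũ(t) + b̃(t)` a.e. for a.e. `t < 0` with a
smooth representative `Ũ` and all the `n = 3` clauses. Put `U(t) = π ∘ Ũ(t) ∘ ι`
(`restrictXY`), `b = π ∘ b̃`.

1. *Good times.* At a.e. `t < 0`, `Ũ(t) + b̃(t)` is a continuous field a.e. equal to one that
   does not depend on `x₂` and has no third component; comparing along the measure-preserving
   vertical translations, `Ũ(t)` is vertically invariant (`isVertInvariant_of_ae_eq_add`) and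
   `Ũ(t)₂ ≡ −b̃(t)₂` (`apply_two_eq_of_ae_eq_add`).
2. *Every time.* Hence `∂_z Ũ(t) = 0` and `(DŨ(t) v)₂ = 0` at a.e. `t`; both quantities are
   Lipschitz in `t` by the order-`1` Lipschitz clause, and a Lipschitz function of `t < 0`
   vanishing at a.e. `t` vanishes at every `t` (`eq_zero_of_ae_restrict_Iio_of_lipschitz`: good
   times meet every interval `(t − ε, t)`); by the mean value theorem along vertical lines `Ũ(t)`
   is vertically invariant at every `t < 0` (`isVertInvariant_of_fderiv_eZ`).
3. *The planar clauses.* The a.e. identity transfers fibrewise (Fubini through the tree's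
   `cylSplit`, one good fibre suffices by vertical invariance); smoothness, the bounds
   `‖DᵏU‖ ≤ ‖DᵏŨ‖` and the Lipschitz constants are composition with the contractions `π`, `ι`
   (`norm_iteratedFDeriv_restrictXY_le`); `div U = div Ũ − (∂_z Ũ)₂ = 0`
   (`divergence_restrictXY`); and the planar vorticity equation is the third component of the
   spatial one (`vorticity_integrand_restrictXY`): `curl2 U = ω₂ ∘ ι` with `ω₂ = (curl Ũ)₂`
   vertically invariant, so `Δ₂(ω₂ ∘ ι) = (Δ₃ ω₂) ∘ ι` and `Dω₂[Ũ + b̃] = Dω₂[ι(U + b)]`, the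
   stretching term `(DŨ[ω])₂` vanishes, and the coordinate projection passes through the time
   integral (`ContinuousLinearMap.intervalIntegral_comp_comm`; the spatial integrand is interval
   integrable, `intervalIntegrable_vorticityIntegrand`, its derivative-level factors being
   continuous in `τ` by the Lipschitz clauses of order `≥ 1` — the `_of_one_le` variants of the
   plumbing lemmas of `KNSSRegularityGluing`, which ask for order `0` too).

## Mathlib / tree search

Tree: the two named facts (`KNSSRegularity`, `KNSSRegularityPlanar`),
`KNSS2009_liouville_planar_of_regularity` (`KNSSLiouvillePlanar`), `curl`, `curl2`,
`curlCLM`, `curl_eq_curlCLM_comp`, `fderiv_curl` (`TaoEnstrophyLocalisation`), the plumbing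
`norm_iteratedFDeriv_fderiv_sub`, `continuousOn_apply_family`, `continuousOn_fderiv_family`,
`continuousOn_iteratedFDeriv_family` (`KNSSRegularityGluing`), `laplacian_eq_sum_fderiv_fderiv_normed`
(`HeatDuhamelBack`), `divergence_eq_sum_inner_fderiv` (`VectorCalculus`), `projXY`/`embedXY`/
`cylSplit_symm_eq` (`PlanarLiftCalculus`), `planarLift`, `fderiv_clm_comp_left_apply`
(`PlanarLiftWeak`), `measurePreserving_cylSplit_symm` (`CylindricalIntegration`). Mathlib:
`is_const_of_deriv_eq_zero`, `fderiv_comp_add_right`, `Continuous.ae_eq_iff_eq`,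
`measurePreserving_add_right`, `Measure.ae_ae_of_ae_prod`, `iteratedFDeriv_sub_apply`,
`ContinuousLinearMap.iteratedFDeriv_comp_left/right`, `ContDiffAt.laplacian_CLM_comp_left`,
`ContinuousLinearMap.intervalIntegral_comp_comm`, `intervalIntegrable_iff_integrableOn_Icc_of_le`,
`PiLp.norm_apply_le`, `Real.volume_Ioo`, `ae_neBot`.

## References

* G. Koch, N. Nadirashvili, G. Seregin, V. Šverák, *Liouville theorems for the Navier–Stokes
  equations and applications*, Acta Math. 203 (2009) 83–105 = arXiv:0709.3599: §4 p. 8 (the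
  closing paragraph on bounded weak solutions, written for general `n`, (4.7)–(4.11)); §5
  Theorem 5.1 and its proof, p. 9 (the planar vorticity `ω = u_{2,1} − u_{1,2}` and its
  equation). [KochNadirashviliSereginSverak2009]
* A. J. Majda, A. L. Bertozzi, *Vorticity and Incompressible Flow*, CUP 2002, §2.3.1
  (two-and-a-half-dimensional flows). [MajdaBertozziCUP2002]
-/

noncomputable section

open MeasureTheory Set Function Filter Topology TopologicalSpace Metric WithLp
open scoped RealInnerProductSpace ContDiff Laplacian

namespace Literature.Analysis.FluidPDE

/-- Local notation for physical space `ℝ³ = EuclideanSpace ℝ (Fin 3)`. -/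
local notation "ℝ³" => EuclideanSpace ℝ (Fin 3)

/-- Local notation for the horizontal plane `ℝ² = EuclideanSpace ℝ (Fin 2)`. -/
local notation "ℝ²" => EuclideanSpace ℝ (Fin 2)

/-! ### Plumbing: families whose derivatives of order `≥ 1` are Lipschitz in time -/

section Plumbing1

variable {V : ℝ → ℝ³ → ℝ³} {S : Set ℝ} {L : ℕ → ℝ}

/-- If the spatial derivatives of order `≥ 1` of a family `V(t, ·)` are Lipschitz in `t` on `S`,
then all derivatives of the gradient family `DV(t, ·)` are (constants `L (k + 1)`). [folklore] -/
theorem lipschitz_family_fderiv_of_one_le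
    (h : ∀ k : ℕ, 1 ≤ k → ∀ s ∈ S, ∀ t ∈ S, ∀ x,
      ‖iteratedFDeriv ℝ k (V t) x - iteratedFDeriv ℝ k (V s) x‖ ≤ L k * |t - s|) :
    ∀ k : ℕ, ∀ s ∈ S, ∀ t ∈ S, ∀ x,
      ‖iteratedFDeriv ℝ k (fderiv ℝ (V t)) x - iteratedFDeriv ℝ k (fderiv ℝ (V s)) x‖ ≤
        L (k + 1) * |t - s| := by
  intro k s hs t ht x
  rw [norm_iteratedFDeriv_fderiv_sub]
  exact h (k + 1) (Nat.le_add_left 1 k) s hs t ht x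

/-- Same family: `t ↦ DV(t, ·)(x)` is continuous on `S`. [folklore] -/
theorem continuousOn_fderiv_family_of_one_le
    (h : ∀ k : ℕ, 1 ≤ k → ∀ s ∈ S, ∀ t ∈ S, ∀ x,
      ‖iteratedFDeriv ℝ k (V t) x - iteratedFDeriv ℝ k (V s) x‖ ≤ L k * |t - s|)
    (x : ℝ³) : ContinuousOn (fun t => fderiv ℝ (V t) x) S :=
  continuousOn_apply_family (lipschitz_family_fderiv_of_one_le h) x

/-- Same family: the vorticity `t ↦ curl V(t, ·)(x)` is continuous on `S`. [folklore] -/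
theorem continuousOn_curl_family_of_one_le
    (h : ∀ k : ℕ, 1 ≤ k → ∀ s ∈ S, ∀ t ∈ S, ∀ x,
      ‖iteratedFDeriv ℝ k (V t) x - iteratedFDeriv ℝ k (V s) x‖ ≤ L k * |t - s|)
    (x : ℝ³) : ContinuousOn (fun t => curl (V t) x) S := by
  simp_rw [curl_eq_curlCLM]
  exact curlCLM.continuous.comp_continuousOn (continuousOn_fderiv_family_of_one_le h x)

/-- Same family: the vorticity gradient `t ↦ D(curl V(t, ·))(x)` is continuous on `S`.
[folklore] -/
theorem continuousOn_fderiv_curl_family_of_one_le (hV : ∀ t ∈ S, ContDiff ℝ ∞ (V t))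
    (h : ∀ k : ℕ, 1 ≤ k → ∀ s ∈ S, ∀ t ∈ S, ∀ x,
      ‖iteratedFDeriv ℝ k (V t) x - iteratedFDeriv ℝ k (V s) x‖ ≤ L k * |t - s|)
    (x : ℝ³) : ContinuousOn (fun t => fderiv ℝ (curl (V t)) x) S := by
  have h2 : ContinuousOn (fun t => fderiv ℝ (fderiv ℝ (V t)) x) S :=
    continuousOn_fderiv_family (lipschitz_family_fderiv_of_one_le h) x
  have h3 : ContinuousOn (fun t => curlCLM.comp (fderiv ℝ (fderiv ℝ (V t)) x)) S :=
    continuousOn_const.clm_comp h2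
  refine h3.congr fun t ht => ?_
  exact fderiv_curl (contDiff_infty.1 (hV t ht) 2) x

/-- Same family: `t ↦ Δ(curl V(t, ·))(x)` is continuous on `S`. [folklore] -/
theorem continuousOn_laplacian_curl_family_of_one_le (hV : ∀ t ∈ S, ContDiff ℝ ∞ (V t))
    (h : ∀ k : ℕ, 1 ≤ k → ∀ s ∈ S, ∀ t ∈ S, ∀ x,
      ‖iteratedFDeriv ℝ k (V t) x - iteratedFDeriv ℝ k (V s) x‖ ≤ L k * |t - s|)
    (x : ℝ³) : ContinuousOn (fun t => Δ (curl (V t)) x) S := by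
  set b := stdOrthonormalBasis ℝ ℝ³ with hb
  have h3 : ContinuousOn (fun t => iteratedFDeriv ℝ 2 (fderiv ℝ (V t)) x) S :=
    continuousOn_iteratedFDeriv_family (lipschitz_family_fderiv_of_one_le h) 2 x
  have hsum : ContinuousOn
      (fun t => ∑ i, iteratedFDeriv ℝ 2 (fderiv ℝ (V t)) x ![b i, b i]) S :=
    continuousOn_finsetSum _ fun i _ =>
      (continuous_eval_const (![b i, b i] : Fin 2 → ℝ³)).comp_continuousOn h3
  have hc : ContinuousOn
      (fun t => curlCLM (∑ i, iteratedFDeriv ℝ 2 (fderiv ℝ (V t)) x ![b i, b i])) S :=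
    curlCLM.continuous.comp_continuousOn hsum
  refine hc.congr fun t ht => ?_
  have hft : ContDiff ℝ 2 (fderiv ℝ (V t)) :=
    (contDiff_infty.1 (hV t ht) 3).fderiv_right (m := 2) (by norm_num)
  show Δ (curl (V t)) x = curlCLM (∑ i, iteratedFDeriv ℝ 2 (fderiv ℝ (V t)) x ![b i, b i])
  rw [curl_eq_curlCLM_comp, ContDiffAt.laplacian_CLM_comp_left hft.contDiffAt,
    Function.comp_apply, InnerProductSpace.laplacian_eq_iteratedFDeriv_stdOrthonormalBasis]

end Plumbing1

/-! ### From almost every time to every time along Lipschitz quantities -/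

section Dense

variable {F : Type*} [NormedAddCommGroup F]

/-- **A Lipschitz-in-time quantity vanishing at a.e. negative time vanishes at every negative
time**: good times have full measure in `(−∞, 0)`, hence meet every interval `(t − ε, t)`.
[folklore] -/
theorem eq_zero_of_ae_restrict_Iio_of_lipschitz {P : ℝ → F} {L : ℝ}
    (hgood : ∀ᵐ s ∂((volume : Measure ℝ).restrict (Iio 0)), P s = 0)
    (hlip : ∀ s < 0, ∀ t < 0, ‖P t - P s‖ ≤ L * |t - s|) : ∀ t < 0, P t = 0 := by
  intro t ht
  have key : ∀ ε : ℝ, 0 < ε → ‖P t‖ ≤ |L| * ε := by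
    intro ε hε
    set S : Set ℝ := Ioo (t - ε) t with hS
    have hSsub : S ⊆ Iio 0 := fun s hs => hs.2.trans ht
    have h1 : ∀ᵐ s ∂((volume : Measure ℝ).restrict S), P s = 0 :=
      ae_restrict_of_ae_restrict_of_subset hSsub hgood
    have h2 : ∀ᵐ s ∂((volume : Measure ℝ).restrict S), s ∈ S := ae_restrict_mem measurableSet_Ioo
    haveI : (ae ((volume : Measure ℝ).restrict S)).NeBot := by
      rw [ae_neBot, Ne, Measure.restrict_eq_zero, hS, Real.volume_Ioo]
      simp [hε]
    obtain ⟨s, hs0, hsS⟩ := (h1.and h2).exists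
    have hs : s < 0 := hSsub hsS
    have hts : |t - s| ≤ ε := by
      rw [abs_of_nonneg (by linarith [hsS.2])]
      linarith [hsS.1]
    calc ‖P t‖ = ‖P t - P s‖ := by rw [hs0, sub_zero]
      _ ≤ L * |t - s| := hlip s hs t ht
      _ ≤ |L| * |t - s| := by gcongr; exact le_abs_self L
      _ ≤ |L| * ε := by gcongr
  have h0 : ‖P t‖ ≤ 0 := by
    refine le_of_forall_pos_le_add fun ε hε => ?_
    have := key (ε / (|L| + 1)) (by positivity)
    rw [zero_add]
    calc ‖P t‖ ≤ |L| * (ε / (|L| + 1)) := this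
      _ ≤ (|L| + 1) * (ε / (|L| + 1)) := by gcongr; linarith
      _ = ε := by field_simp
  exact norm_le_zero_iff.1 h0

end Dense

/-! ### Vertical invariance of fields on `ℝ³` -/

section Invariance

variable {G : Type*} [NormedAddCommGroup G] [NormedSpace ℝ G]

/-- A field `f` on `ℝ³` is **vertically invariant** if `f (x + z e_z) = f x`. [folklore] -/
def IsVertInvariant (f : ℝ³ → G) : Prop :=
  ∀ (x : ℝ³) (z : ℝ), f (x + z • eZ) = f x

/-- The gradient of a vertically invariant field is vertically invariant. [folklore] -/
theorem IsVertInvariant.isVertInvariant_fderiv {f : ℝ³ → G} (hf : IsVertInvariant f) :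
    IsVertInvariant (fderiv ℝ f) := by
  intro x z
  rw [← fderiv_comp_add_right]
  congr 1
  funext y
  exact hf y z

omit [NormedAddCommGroup G] [NormedSpace ℝ G] in
/-- Post-composition preserves vertical invariance. [folklore] -/
theorem IsVertInvariant.comp {f : ℝ³ → G} (hf : IsVertInvariant f) {H : Type*} (g : G → H) :
    IsVertInvariant (g ∘ f) := fun x z => by
  simp only [Function.comp_apply, hf x z]

/-- The vertical derivative of a differentiable vertically invariant field vanishes. [folklore] -/
theorem IsVertInvariant.fderiv_eZ {f : ℝ³ → G} (hf : IsVertInvariant f) {x : ℝ³}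
    (hd : DifferentiableAt ℝ f x) : fderiv ℝ f x eZ = 0 := by
  have h1 : HasDerivAt (fun s : ℝ => x + s • eZ) eZ 0 := by
    simpa using ((hasDerivAt_id (0 : ℝ)).smul_const (eZ : ℝ³)).const_add x
  have h2 : HasDerivAt (fun s : ℝ => f (x + s • eZ)) (fderiv ℝ f x eZ) 0 := by
    have hd0 : DifferentiableAt ℝ f (x + (0 : ℝ) • eZ) := by simpa using hd
    have := hd0.hasFDerivAt.comp_hasDerivAt (0 : ℝ) h1
    rw [zero_smul, add_zero] at this
    exact this
  have h3 : (fun s : ℝ => f (x + s • eZ)) = fun _ => f x := funext fun s => hf x s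
  rw [h3] at h2
  exact h2.unique (hasDerivAt_const 0 (f x))

/-- Conversely, a differentiable field with vanishing vertical derivative is vertically
invariant (mean value theorem along vertical lines). [folklore] -/
theorem isVertInvariant_of_fderiv_eZ {f : ℝ³ → G} (hd : Differentiable ℝ f)
    (h0 : ∀ x, fderiv ℝ f x eZ = 0) : IsVertInvariant f := by
  intro x z
  have hderiv : ∀ s : ℝ, HasDerivAt (fun s : ℝ => f (x + s • eZ)) 0 s := by
    intro s
    have h1 : HasDerivAt (fun s : ℝ => x + s • eZ) eZ s := by
      simpa using ((hasDerivAt_id s).smul_const (eZ : ℝ³)).const_add x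
    have := (hd _).hasFDerivAt.comp_hasDerivAt s h1
    rw [h0] at this
    exact this
  have hdiff : Differentiable ℝ fun s : ℝ => f (x + s • eZ) := fun s => (hderiv s).differentiableAt
  have := is_const_of_deriv_eq_zero hdiff (fun s => (hderiv s).deriv) z 0
  simpa using this

/-- **The Laplacian of a vertically invariant field is the planar Laplacian of its restriction
to the horizontal plane**: `Δ₃ f (ι w) = Δ₂ (f ∘ ι) w` for `f ∈ C²` vertically invariant (over
the coordinate frames, the vertical second derivative vanishes). [folklore] -/
theorem IsVertInvariant.laplacian_comp_embedXY {f : ℝ³ → G} (hf : IsVertInvariant f)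
    (hs : ContDiff ℝ 2 f) (w : ℝ²) :
    Δ (fun w => f (embedXY w)) w = Δ f (embedXY w) := by
  classical
  have hfι : ContDiff ℝ 2 (fun w => f (embedXY w)) := hs.comp embedXY.contDiff
  rw [laplacian_eq_sum_fderiv_fderiv_normed (EuclideanSpace.basisFun (Fin 2) ℝ) hfι,
    laplacian_eq_sum_fderiv_fderiv_normed (EuclideanSpace.basisFun (Fin 3) ℝ) hs]
  conv_rhs => rw [Fin.sum_univ_castSucc]
  have hd : ∀ y, DifferentiableAt ℝ f y := fun y => (hs.differentiable (by norm_num)) y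
  -- the vertical second derivative vanishes
  have hlast : fderiv ℝ (fun y => fderiv ℝ f y (EuclideanSpace.basisFun (Fin 3) ℝ (Fin.last 2)))
      (embedXY w) (EuclideanSpace.basisFun (Fin 3) ℝ (Fin.last 2)) = 0 := by
    have he : EuclideanSpace.basisFun (Fin 3) ℝ (Fin.last 2) = eZ := by
      rw [EuclideanSpace.basisFun_apply]; rfl
    have hz : (fun y => fderiv ℝ f y eZ) = fun _ => (0 : G) := funext fun y => hf.fderiv_eZ (hd y)
    rw [he, hz, fderiv_fun_const, Pi.zero_apply]
    rfl
  rw [hlast, add_zero]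
  refine Finset.sum_congr rfl fun i _ => ?_
  -- horizontal partials of `f ∘ ι` are the corresponding partials of `f`, restricted
  have hchain : ∀ {g : ℝ³ → G}, Differentiable ℝ g → ∀ (w v : ℝ²),
      fderiv ℝ (fun w => g (embedXY w)) w v = fderiv ℝ g (embedXY w) (embedXY v) := by
    intro g hg w v
    have := ((hg (embedXY w)).hasFDerivAt.comp w embedXY.hasFDerivAt).fderiv
    rw [show (fun w => g (embedXY w)) = g ∘ embedXY from rfl, this]
    rfl
  have h1 : (fun w => fderiv ℝ (fun w => f (embedXY w)) w (EuclideanSpace.basisFun (Fin 2) ℝ i)) =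
      fun w => fderiv ℝ f (embedXY w) (EuclideanSpace.basisFun (Fin 3) ℝ (Fin.castSucc i)) := by
    funext w
    rw [hchain (hs.differentiable (by norm_num)), EuclideanSpace.basisFun_apply,
      EuclideanSpace.basisFun_apply, embedXY_single]
  rw [h1]
  have hdg : Differentiable ℝ fun y => fderiv ℝ f y
      (EuclideanSpace.basisFun (Fin 3) ℝ (Fin.castSucc i)) :=
    ((hs.fderiv_right (m := 1) le_rfl).differentiable one_ne_zero).clm_apply
      (differentiable_const _)
  rw [hchain hdg, EuclideanSpace.basisFun_apply, EuclideanSpace.basisFun_apply, embedXY_single]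

end Invariance


/-! ### The horizontal part of a spatial field restricted to the plane -/

section Restrict

/-- The **horizontal restriction** of a field on `ℝ³`: `restrictXY f w = π (f (ι w))`, the
horizontal part of `f` on the plane `x₂ = 0`. [folklore] -/
def restrictXY (f : ℝ³ → ℝ³) (w : ℝ²) : ℝ² :=
  projXY (f (embedXY w))

/-- Unfolding `restrictXY`. [folklore] -/
@[simp]
theorem restrictXY_apply (f : ℝ³ → ℝ³) (w : ℝ²) : restrictXY f w = projXY (f (embedXY w)) := rfl

/-- `restrictXY f = π ∘ f ∘ ι`. [folklore] -/
theorem restrictXY_eq_comp (f : ℝ³ → ℝ³) : restrictXY f = projXY ∘ (f ∘ embedXY) := rfl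

/-- `restrictXY` is additive: `restrictXY (f − g) = restrictXY f − restrictXY g`. [folklore] -/
theorem restrictXY_sub (f g : ℝ³ → ℝ³) : restrictXY (f - g) = restrictXY f - restrictXY g := by
  funext w; simp

/-- Smooth fields restrict to smooth fields. [folklore] -/
theorem contDiff_restrictXY {f : ℝ³ → ℝ³} {n : WithTop ℕ∞} (hf : ContDiff ℝ n f) :
    ContDiff ℝ n (restrictXY f) :=
  projXY.contDiff.comp (hf.comp embedXY.contDiff)

/-- **Chain rule for the restriction**: `D(restrictXY f)(w)(v) = π (Df(ι w)(ι v))`. [folklore] -/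
theorem fderiv_restrictXY_apply {f : ℝ³ → ℝ³} {w : ℝ²} (hf : DifferentiableAt ℝ f (embedXY w))
    (v : ℝ²) : fderiv ℝ (restrictXY f) w v = projXY (fderiv ℝ f (embedXY w) (embedXY v)) := by
  have h : HasFDerivAt (restrictXY f) ((projXY.comp (fderiv ℝ f (embedXY w))).comp embedXY) w :=
    (projXY.hasFDerivAt.comp _ hf.hasFDerivAt).comp w embedXY.hasFDerivAt
  rw [h.fderiv]
  rfl

/-- **Derivative bounds restrict**: `‖Dᵏ(restrictXY f)(w)‖ ≤ ‖Dᵏf(ι w)‖` (composition with the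
contractions `π`, `ι`). [folklore] -/
theorem norm_iteratedFDeriv_restrictXY_le {f : ℝ³ → ℝ³} (hf : ContDiff ℝ ∞ f) (k : ℕ) (w : ℝ²) :
    ‖iteratedFDeriv ℝ k (restrictXY f) w‖ ≤ ‖iteratedFDeriv ℝ k f (embedXY w)‖ := by
  have hk : (k : WithTop ℕ∞) ≤ ∞ := by exact_mod_cast le_top
  have hfι : ContDiff ℝ ∞ (f ∘ embedXY) := hf.comp embedXY.contDiff
  rw [restrictXY_eq_comp, projXY.iteratedFDeriv_comp_left hfι.contDiffAt hk,
    embedXY.iteratedFDeriv_comp_right hf w hk]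
  refine (ContinuousLinearMap.norm_compContinuousMultilinearMap_le _ _).trans ?_
  refine (mul_le_mul norm_projXY_clm_le (ContinuousMultilinearMap.norm_compContinuousLinearMap_le _ _)
    (norm_nonneg _) zero_le_one).trans ?_
  rw [one_mul]
  refine (mul_le_of_le_one_right (norm_nonneg _) ?_)
  exact Finset.prod_le_one (fun i _ => norm_nonneg _) fun i _ => norm_embedXY_clm_le

/-- **The planar vorticity of the restriction is the vertical vorticity**:
`curl2 (restrictXY f) w = (curl f (ι w))₂`. [folklore] -/
theorem curl2_restrictXY {f : ℝ³ → ℝ³} {w : ℝ²} (hf : DifferentiableAt ℝ f (embedXY w)) :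
    curl2 (restrictXY f) w = curl f (embedXY w) 2 := by
  rw [curl2_apply, fderiv_restrictXY_apply hf, fderiv_restrictXY_apply hf, projXY_apply_one,
    projXY_apply_zero, embedXY_single 0, embedXY_single 1]
  simp [curl]

/-- **The divergence of the restriction**: `div (restrictXY f) w = div f (ι w) − (Df(ι w) e_z)₂`.
[folklore] -/
theorem divergence_restrictXY {f : ℝ³ → ℝ³} {w : ℝ²} (hf : DifferentiableAt ℝ f (embedXY w)) :
    VectorCalculus.divergence (restrictXY f) w =
      VectorCalculus.divergence f (embedXY w) - fderiv ℝ f (embedXY w) eZ 2 := by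
  classical
  rw [divergence_eq_sum_inner_fderiv (EuclideanSpace.basisFun (Fin 2) ℝ),
    divergence_eq_sum_inner_fderiv (EuclideanSpace.basisFun (Fin 3) ℝ)]
  conv_rhs => rw [Fin.sum_univ_castSucc]
  have he : EuclideanSpace.basisFun (Fin 3) ℝ (Fin.last 2) = eZ := by
    rw [EuclideanSpace.basisFun_apply]; rfl
  rw [he, eq_sub_iff_add_eq]
  congr 1
  · refine Finset.sum_congr rfl fun i _ => ?_
    rw [fderiv_restrictXY_apply hf, ← inner_embedXY_left, EuclideanSpace.basisFun_apply,
      EuclideanSpace.basisFun_apply, embedXY_single]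
  · simp [eZ, EuclideanSpace.inner_single_left]

end Restrict

/-! ### Good times: what the a.e. identity `ũ(t) = Ũ(t) + b̃(t)` forces on a continuous `Ũ(t)` -/

section GoodTimes

/-- Horizontal chain rule: `D(g ∘ ι)(w)(v) = Dg(ι w)(ι v)`. [folklore] -/
theorem fderiv_comp_embedXY_apply {G : Type*} [NormedAddCommGroup G] [NormedSpace ℝ G]
    {g : ℝ³ → G} {w : ℝ²} (hg : DifferentiableAt ℝ g (embedXY w)) (v : ℝ²) :
    fderiv ℝ (fun w => g (embedXY w)) w v = fderiv ℝ g (embedXY w) (embedXY v) := by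
  have := (hg.hasFDerivAt.comp w embedXY.hasFDerivAt).fderiv
  rw [show (fun w => g (embedXY w)) = g ∘ embedXY from rfl, this]
  rfl

/-- **Vertical invariance at a good time.** If a continuous field `v` on `ℝ³` agrees a.e. with
`x ↦ ι(a(π x)) − c` — a field which does not depend on `x₂` — then `v` is vertically invariant
(compose the a.e. identity with the measure-preserving vertical translations and compare
continuous representatives). [folklore] -/
theorem isVertInvariant_of_ae_eq_add {v : ℝ³ → ℝ³} {c : ℝ³} {a : ℝ² → ℝ²} (hv : Continuous v)
    (hae : (fun x => embedXY (a (projXY x))) =ᵐ[volume] fun x => v x + c) :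
    IsVertInvariant v := by
  intro x z
  have hT : MeasurePreserving (fun y : ℝ³ => y + z • eZ) volume volume :=
    measurePreserving_add_right volume (z • eZ)
  have h1 : (fun y => v (y + z • eZ) + c) =ᵐ[volume] fun y => embedXY (a (projXY (y + z • eZ))) :=
    hT.quasiMeasurePreserving.ae_eq hae.symm
  have h2 : (fun y : ℝ³ => embedXY (a (projXY (y + z • eZ)))) = fun y => embedXY (a (projXY y)) := by
    funext y; rw [projXY_add_smul_eZ]
  rw [h2] at h1
  have h3 : (fun y => v (y + z • eZ) + c) =ᵐ[volume] fun y => v y + c := h1.trans hae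
  have h4 : (fun y => v (y + z • eZ) + c) = fun y => v y + c :=
    (Continuous.ae_eq_iff_eq volume
      ((hv.comp (continuous_id.add continuous_const)).add continuous_const)
      (hv.add continuous_const)).1 h3
  have := congrFun h4 x
  simpa using this

/-- **No vertical velocity at a good time.** Under the same a.e. identity the third component of
`v` is the constant `−c₂`. [folklore] -/
theorem apply_two_eq_of_ae_eq_add {v : ℝ³ → ℝ³} {c : ℝ³} {a : ℝ² → ℝ²} (hv : Continuous v)
    (hae : (fun x => embedXY (a (projXY x))) =ᵐ[volume] fun x => v x + c) (x : ℝ³) :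
    v x 2 + c 2 = 0 := by
  have h1 : (fun x => v x 2 + c 2) =ᵐ[volume] fun _ => (0 : ℝ) := by
    filter_upwards [hae] with y hy
    have := congrArg (fun w : ℝ³ => w 2) hy
    simp only [embedXY_apply_two, PiLp.add_apply] at this
    linarith
  have hc2 : Continuous fun x => v x 2 + c 2 :=
    ((EuclideanSpace.proj (2 : Fin 3)).continuous.comp hv).add continuous_const
  have h2 := (Continuous.ae_eq_iff_eq volume hc2 continuous_const).1 h1
  exact congrFun h2 x

end GoodTimes

/-! ### The vorticity integrand of the restriction -/

section Vorticity

/-- **The planar vorticity equation is the vertical component of the spatial one.** For a smooth,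
vertically invariant field `f` on `ℝ³` whose gradient has no vertical component
(`(Df(y) v)₂ = 0`), and any `c ∈ ℝ³`: with `U = restrictXY f`, `b = π c`,
`Δ(curl2 U)(w) − D(curl2 U)(w)[U w + b] = (Δ(curl f) − D(curl f)[f + c] + Df[curl f])₂ (ι w)` —
the stretching term has no vertical component, the vertical vorticity `ω₂` is vertically
invariant (so `Δ₃ ω₂ = Δ₂ (ω₂ ∘ ι)` and `Dω₂ e_z = 0`), and `curl2 U = ω₂ ∘ ι`. [folklore] -/
theorem vorticity_integrand_restrictXY {f : ℝ³ → ℝ³} (hf : ContDiff ℝ ∞ f) (hinv : IsVertInvariant f)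
    (h2 : ∀ y v, fderiv ℝ f y v 2 = 0) (c : ℝ³) (w : ℝ²) :
    Δ (curl2 (restrictXY f)) w - fderiv ℝ (curl2 (restrictXY f)) w (restrictXY f w + projXY c) =
      (Δ (curl f) (embedXY w) - fderiv ℝ (curl f) (embedXY w) (f (embedXY w) + c) +
        fderiv ℝ f (embedXY w) (curl f (embedXY w))) 2 := by
  set P2 : ℝ³ →L[ℝ] ℝ := EuclideanSpace.proj (2 : Fin 3) with hP2
  set om : ℝ³ → ℝ³ := curl f with homdef
  set omz : ℝ³ → ℝ := fun y => P2 (om y) with homzdef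
  have hdf : Differentiable ℝ f := hf.differentiable (by simp)
  have hom : ContDiff ℝ ∞ om := by
    rw [homdef, curl_eq_curlCLM_comp]; exact curlCLM.contDiff.comp (hf.fderiv_right le_rfl)
  have homz : ContDiff ℝ ∞ omz := P2.contDiff.comp hom
  have hominv : IsVertInvariant om := by
    rw [homdef, curl_eq_curlCLM_comp]; exact hinv.isVertInvariant_fderiv.comp _
  have homzinv : IsVertInvariant omz := hominv.comp P2
  have hcurl2 : curl2 (restrictXY f) = fun w => omz (embedXY w) :=
    funext fun w => curl2_restrictXY (hdf _)
  have homd : ∀ y, DifferentiableAt ℝ om y := fun y => (hom.differentiable (by simp)) y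
  have homzd : ∀ y, DifferentiableAt ℝ omz y := fun y => (homz.differentiable (by simp)) y
  -- components of the spatial integrand
  have hA : (Δ om (embedXY w)) 2 = Δ (curl2 (restrictXY f)) w := by
    rw [hcurl2, homzinv.laplacian_comp_embedXY (contDiff_infty.1 homz 2) w]
    have := ((contDiff_infty.1 hom 2).contDiffAt (x := embedXY w)).laplacian_CLM_comp_left
      (l := P2)
    exact this.symm
  have hB : (fderiv ℝ om (embedXY w) (f (embedXY w) + c)) 2 =
      fderiv ℝ (curl2 (restrictXY f)) w (restrictXY f w + projXY c) := by
    rw [hcurl2, fderiv_comp_embedXY_apply (homzd _), restrictXY_apply, ← map_add]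
    set v : ℝ³ := f (embedXY w) + c with hv
    have hsplit : fderiv ℝ omz (embedXY w) v =
        fderiv ℝ omz (embedXY w) (embedXY (projXY v)) + v 2 • fderiv ℝ omz (embedXY w) eZ := by
      conv_lhs => rw [← embedXY_projXY_add v]
      rw [map_add, map_smul]
    have e1 : (fderiv ℝ om (embedXY w) v) 2 = fderiv ℝ omz (embedXY w) v :=
      (fderiv_clm_comp_left_apply (homd _) P2 v).symm
    rw [e1, hsplit, homzinv.fderiv_eZ (homzd _), smul_zero, add_zero]
  have hC : (fderiv ℝ f (embedXY w) (om (embedXY w))) 2 = 0 := h2 _ _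
  rw [PiLp.add_apply, PiLp.sub_apply, hA, hB, hC, add_zero]

end Vorticity

/-! ### The planar fact from the spatial fact -/

section Main

/-- Uniformising the Lipschitz constants of the spatial fact into a sequence `L k`. [folklore] -/
theorem exists_lipschitz_seq {Ut : ℝ → ℝ³ → ℝ³}
    (hlip : ∀ k : ℕ, 1 ≤ k → ∃ L : ℝ, ∀ s < 0, ∀ t < 0, ∀ x,
      ‖iteratedFDeriv ℝ k (Ut t) x - iteratedFDeriv ℝ k (Ut s) x‖ ≤ L * |t - s|) :
    ∃ L : ℕ → ℝ, ∀ k : ℕ, 1 ≤ k → ∀ s ∈ Iio (0 : ℝ), ∀ t ∈ Iio (0 : ℝ), ∀ x,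
      ‖iteratedFDeriv ℝ k (Ut t) x - iteratedFDeriv ℝ k (Ut s) x‖ ≤ L k * |t - s| := by
  classical
  refine ⟨fun k => if hk : 1 ≤ k then Classical.choose (hlip k hk) else 0,
    fun k hk s hs t ht x => ?_⟩
  simp only [dif_pos hk]
  exact Classical.choose_spec (hlip k hk) s hs t ht x

/-- **Interval integrability of the spatial vorticity integrand** along `[s, t] ⊆ (−∞, 0)` for the
representative of the spatial fact: the derivative-level factors are continuous in `τ`
(Lipschitz clauses of order `≥ 1`), the order-zero factor `Ũ(τ, y) + b̃(τ)` is bounded and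
measurable. [folklore] -/
theorem intervalIntegrable_vorticityIntegrand {Ut : ℝ → ℝ³ → ℝ³} {bt : ℝ → ℝ³}
    (hbm : Measurable bt) {Cb : ℝ} (hCb : ∀ t, ‖bt t‖ ≤ Cb) (hUm : Measurable (uncurry Ut))
    (hsm : ∀ t < 0, ContDiff ℝ ∞ (Ut t))
    (hbd0 : ∃ C : ℝ, ∀ t < 0, ∀ x, ‖iteratedFDeriv ℝ 0 (Ut t) x‖ ≤ C)
    (hlip : ∀ k : ℕ, 1 ≤ k → ∃ L : ℝ, ∀ s < 0, ∀ t < 0, ∀ x,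
      ‖iteratedFDeriv ℝ k (Ut t) x - iteratedFDeriv ℝ k (Ut s) x‖ ≤ L * |t - s|)
    (y : ℝ³) {s t : ℝ} (hst : s ≤ t) (ht : t < 0) :
    IntervalIntegrable (fun τ => Δ (curl (Ut τ)) y -
      fderiv ℝ (curl (Ut τ)) y (Ut τ y + bt τ) + fderiv ℝ (Ut τ) y (curl (Ut τ) y)) volume s t := by
  obtain ⟨L, hL⟩ := exists_lipschitz_seq hlip
  have hsm' : ∀ τ ∈ Iio (0 : ℝ), ContDiff ℝ ∞ (Ut τ) := fun τ hτ => hsm τ hτ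
  have hsub : uIcc s t ⊆ Iio 0 := by
    rw [uIcc_of_le hst]; exact fun τ hτ => lt_of_le_of_lt hτ.2 ht
  have hIcc : Icc s t ⊆ Iio 0 := fun τ hτ => lt_of_le_of_lt hτ.2 ht
  have hA1 : ContinuousOn (fun τ => Δ (curl (Ut τ)) y) (Iio 0) :=
    continuousOn_laplacian_curl_family_of_one_le hsm' hL y
  have hA2 : ContinuousOn (fun τ => fderiv ℝ (curl (Ut τ)) y) (Iio 0) :=
    continuousOn_fderiv_curl_family_of_one_le hsm' hL y
  have hA3 : ContinuousOn (fun τ => fderiv ℝ (Ut τ) y) (Iio 0) :=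
    continuousOn_fderiv_family_of_one_le hL y
  have hA4 : ContinuousOn (fun τ => curl (Ut τ) y) (Iio 0) :=
    continuousOn_curl_family_of_one_le hL y
  have hF1 : IntervalIntegrable (fun τ => Δ (curl (Ut τ)) y) volume s t :=
    (hA1.mono hsub).intervalIntegrable
  have hF3 : IntervalIntegrable (fun τ => fderiv ℝ (Ut τ) y (curl (Ut τ) y)) volume s t :=
    ((hA3.clm_apply hA4).mono hsub).intervalIntegrable
  have hF2 : IntervalIntegrable (fun τ => fderiv ℝ (curl (Ut τ)) y (Ut τ y + bt τ)) volume s t := by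
    rw [intervalIntegrable_iff_integrableOn_Icc_of_le hst]
    obtain ⟨M, hM⟩ := isCompact_Icc.exists_bound_of_continuousOn (hA2.mono hIcc)
    obtain ⟨C0, hC0⟩ := hbd0
    have hc : Measurable fun τ => Ut τ y + bt τ :=
      (hUm.comp (measurable_id.prodMk measurable_const)).add hbm
    refine Integrable.mono' (integrable_const (M * (C0 + Cb))) ?_ ?_
    · exact isBoundedBilinearMap_apply.continuous.comp_aestronglyMeasurable
        (((hA2.mono hIcc).aestronglyMeasurable measurableSet_Icc).prodMk hc.aestronglyMeasurable)
    · refine (ae_restrict_mem measurableSet_Icc).mono fun τ hτ => ?_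
      have hτ0 : τ < 0 := hIcc hτ
      have h0 : ‖Ut τ y‖ ≤ C0 := by rw [← norm_iteratedFDeriv_zero (𝕜 := ℝ)]; exact hC0 τ hτ0 y
      calc ‖fderiv ℝ (curl (Ut τ)) y (Ut τ y + bt τ)‖
          ≤ ‖fderiv ℝ (curl (Ut τ)) y‖ * ‖Ut τ y + bt τ‖ := ContinuousLinearMap.le_opNorm _ _
        _ ≤ M * (C0 + Cb) := by
          have hM0 : 0 ≤ M := (norm_nonneg _).trans (hM τ hτ)
          gcongr
          · exact hM τ hτ
          · exact (norm_add_le _ _).trans (add_le_add h0 (hCb τ))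
  exact (hF1.sub hF2).add hF3

/-- **KNSS 2009, §4 for bounded weak solutions: the planar (`n = 2`) ancient fact from the
spatial (`n = 3`) one** (Acta Math. 203 (2009) = arXiv:0709.3599; §4 p. 8 is written for
`u : ℝⁿ × (0, T) → ℝⁿ`, and the tree vendors its ancient form twice,
`KNSS2009_regularity_boundedWeak_ancient` for `ℝ³` and
`KNSS2009_regularity_boundedWeak_ancient_planar` for `ℝ²`; this theorem shows the second is a
*consequence* of the first). Given a bounded weak solution `u` on `ℝ² × (−∞, 0)`, its planar lift
`ũ = (u ∘ π, 0)` is a bounded weak solution on `ℝ³ × (−∞, 0)` (`IsBoundedWeakNSSolutionOn.planarLift`);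
the spatial fact yields `ũ = Ũ + b̃(t)` with a smooth representative `Ũ`; at a.e. time `Ũ(t, ·)`
is vertically invariant with horizontal third component (the a.e. identity compared along
vertical translations, `isVertInvariant_of_ae_eq_add`, `apply_two_eq_of_ae_eq_add`), hence
`∂_z Ũ = 0` and `(DŨ v)₂ = 0` at *every* negative time by the Lipschitz-in-time clause
(`eq_zero_of_ae_restrict_Iio_of_lipschitz`); and then `U(t) = π ∘ Ũ(t) ∘ ι`, `b = π ∘ b̃`
satisfy every planar clause: the a.e. identity fibrewise (Fubini through `cylSplit`), smoothness,
`div U = div Ũ − (∂_z Ũ)₂ = 0`, the derivative bounds and Lipschitz constants (compositions with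
the contractions `π`, `ι`), and the planar vorticity equation as the vertical component of the
spatial one (`vorticity_integrand_restrictXY`, the interval integral commuting with the
coordinate projection). [cite: KochNadirashviliSereginSverak2009, §4 p. 8 (closing paragraph, written for general n) with §5 proof of Thm 5.1, first display (arXiv p. 9)] -/
theorem KNSS2009_regularity_boundedWeak_ancient_planar_of_ancient
    (h3 : KNSS2009_regularity_boundedWeak_ancient) :
    KNSS2009_regularity_boundedWeak_ancient_planar := by
  intro u hu
  obtain ⟨Ut, bt, hbm, ⟨Cb, hCb⟩, hUm, hae, hsm, hdf, hbd, hlip, hvort⟩ := h3 hu.planarLift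
  have hdiff : ∀ t < 0, Differentiable ℝ (Ut t) := fun t ht => (hsm t ht).differentiable (by simp)
  -- good times
  have hgood : ∀ᵐ t ∂((volume : Measure ℝ).restrict (Iio 0)),
      t < 0 ∧ (planarLift u t =ᵐ[volume] fun x => Ut t x + bt t) := by
    filter_upwards [ae_restrict_mem measurableSet_Iio, hae] with t ht h using ⟨ht, h⟩
  -- Lipschitz bound of the gradient family (order 1)
  obtain ⟨L1, hL1⟩ := hlip 1 le_rfl
  have hDlip : ∀ s < 0, ∀ t < 0, ∀ x, ‖fderiv ℝ (Ut t) x - fderiv ℝ (Ut s) x‖ ≤ L1 * |t - s| := by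
    intro s hs t ht x
    rw [norm_sub_eq_norm_iteratedFDeriv_zero_sub, norm_iteratedFDeriv_fderiv_sub]
    exact hL1 s hs t ht x
  -- (Z1) the vertical derivative vanishes at every negative time
  have hZ1 : ∀ t < 0, ∀ x, fderiv ℝ (Ut t) x eZ = 0 := by
    intro t ht x
    refine eq_zero_of_ae_restrict_Iio_of_lipschitz (P := fun t => fderiv ℝ (Ut t) x eZ)
      (L := L1 * ‖(eZ : ℝ³)‖) ?_ ?_ t ht
    · filter_upwards [hgood] with s hs
      exact (isVertInvariant_of_ae_eq_add (hsm s hs.1).continuous hs.2).fderiv_eZ (hdiff s hs.1 x)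
    · intro s hs t' ht'
      calc ‖fderiv ℝ (Ut t') x eZ - fderiv ℝ (Ut s) x eZ‖
          = ‖(fderiv ℝ (Ut t') x - fderiv ℝ (Ut s) x) eZ‖ := by
            simp only [FunLike.coe_sub, Pi.sub_apply]
        _ ≤ ‖fderiv ℝ (Ut t') x - fderiv ℝ (Ut s) x‖ * ‖(eZ : ℝ³)‖ :=
            ContinuousLinearMap.le_opNorm _ _
        _ ≤ L1 * |t' - s| * ‖(eZ : ℝ³)‖ := by gcongr; exact hDlip s hs t' ht' x
        _ = L1 * ‖(eZ : ℝ³)‖ * |t' - s| := by ring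
  -- (Z2) the gradient has no vertical component at every negative time
  have hZ2 : ∀ t < 0, ∀ x v, fderiv ℝ (Ut t) x v 2 = 0 := by
    intro t ht x v
    refine eq_zero_of_ae_restrict_Iio_of_lipschitz (P := fun t => fderiv ℝ (Ut t) x v 2)
      (L := L1 * ‖v‖) ?_ ?_ t ht
    · filter_upwards [hgood] with s hs
      have hconst : (fun y => (EuclideanSpace.proj (2 : Fin 3) : ℝ³ →L[ℝ] ℝ) (Ut s y)) =
          fun _ => -(bt s 2) := by
        funext y
        have := apply_two_eq_of_ae_eq_add (hsm s hs.1).continuous hs.2 y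
        change Ut s y 2 = _
        linarith
      have e1 := fderiv_clm_comp_left_apply (hdiff s hs.1 x)
        (EuclideanSpace.proj (2 : Fin 3) : ℝ³ →L[ℝ] ℝ) v
      rw [hconst, fderiv_fun_const, Pi.zero_apply] at e1
      exact e1.symm
    · intro s hs t' ht'
      calc ‖fderiv ℝ (Ut t') x v 2 - fderiv ℝ (Ut s) x v 2‖
          = ‖((fderiv ℝ (Ut t') x - fderiv ℝ (Ut s) x) v) 2‖ := by
            simp only [FunLike.coe_sub, Pi.sub_apply, PiLp.sub_apply]
        _ ≤ ‖(fderiv ℝ (Ut t') x - fderiv ℝ (Ut s) x) v‖ := PiLp.norm_apply_le _ _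
        _ ≤ ‖fderiv ℝ (Ut t') x - fderiv ℝ (Ut s) x‖ * ‖v‖ := ContinuousLinearMap.le_opNorm _ _
        _ ≤ L1 * |t' - s| * ‖v‖ := by gcongr; exact hDlip s hs t' ht' x
        _ = L1 * ‖v‖ * |t' - s| := by ring
  -- vertical invariance at every negative time
  have hinv : ∀ t < 0, IsVertInvariant (Ut t) := fun t ht =>
    isVertInvariant_of_fderiv_eZ (hdiff t ht) (hZ1 t ht)
  -- the planar data `U = π ∘ Ũ ∘ ι`, `b = π ∘ b̃`
  refine ⟨fun t => restrictXY (Ut t), fun t => projXY (bt t), projXY.continuous.measurable.comp hbm,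
    ⟨Cb, fun t => ?_⟩, ?_, ?_, fun t ht => contDiff_restrictXY (hsm t ht), ?_, ?_, ?_, ?_⟩
  · -- bound of the drift
    refine (projXY.le_opNorm _).trans ?_
    exact (mul_le_of_le_one_left (norm_nonneg _) norm_projXY_clm_le).trans (hCb t)
  · -- joint measurability of `U`
    have heq : uncurry (fun t => restrictXY (Ut t)) =
        projXY ∘ uncurry Ut ∘ fun p : ℝ × ℝ² => (p.1, embedXY p.2) := by
      funext p; obtain ⟨t, w⟩ := p; rfl
    rw [heq]
    exact projXY.continuous.measurable.comp
      (hUm.comp (measurable_fst.prodMk (embedXY.continuous.measurable.comp measurable_snd)))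
  · -- the a.e. identity, fibrewise
    filter_upwards [hgood] with t ht
    obtain ⟨ht0, hae_t⟩ := ht
    have h1 : ∀ᵐ p : ℝ × ℝ² ∂((volume : Measure ℝ).prod (volume : Measure ℝ²)),
        planarLift u t (cylSplit.symm p) = Ut t (cylSplit.symm p) + bt t :=
      measurePreserving_cylSplit_symm.quasiMeasurePreserving.ae hae_t
    obtain ⟨z, hz⟩ := (Measure.ae_ae_of_ae_prod h1).exists
    filter_upwards [hz] with w hw
    rw [planarLift_cylSplit_symm, cylSplit_symm_eq, hinv t ht0] at hw
    have := congrArg projXY hw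
    rw [projXY_embedXY, map_add] at this
    exact this
  · -- divergence free
    intro t ht w
    rw [divergence_restrictXY (hdiff t ht _), hdf t ht (embedXY w), hZ1 t ht]
    simp
  · -- uniform derivative bounds
    intro k
    obtain ⟨C, hC⟩ := hbd k
    exact ⟨C, fun t ht w => (norm_iteratedFDeriv_restrictXY_le (hsm t ht) k w).trans (hC t ht _)⟩
  · -- Lipschitz in time of the derivatives of order `≥ 1`
    intro k hk
    obtain ⟨L, hL⟩ := hlip k hk
    refine ⟨L, fun s hs t ht w => ?_⟩
    have hk' : (k : WithTop ℕ∞) ≤ ∞ := by exact_mod_cast le_top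
    rw [← iteratedFDeriv_sub_apply ((contDiff_restrictXY (hsm t ht)).of_le hk').contDiffAt
      ((contDiff_restrictXY (hsm s hs)).of_le hk').contDiffAt, ← restrictXY_sub]
    have e2 : iteratedFDeriv ℝ k (Ut t - Ut s) (embedXY w) =
        iteratedFDeriv ℝ k (Ut t) (embedXY w) - iteratedFDeriv ℝ k (Ut s) (embedXY w) :=
      iteratedFDeriv_sub_apply (((hsm t ht).of_le hk').contDiffAt)
        (((hsm s hs).of_le hk').contDiffAt)
    refine (norm_iteratedFDeriv_restrictXY_le (f := Ut t - Ut s) ((hsm t ht).sub (hsm s hs)) k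
      w).trans ?_
    rw [e2]
    exact hL s hs t ht _
  · -- the planar vorticity equation as the vertical component of the spatial one
    intro w s t hst ht
    have hs : s < 0 := lt_of_le_of_lt hst ht
    have key := hvort (embedXY w) s t hst ht
    have hint := intervalIntegrable_vorticityIntegrand hbm hCb hUm hsm (hbd 0) hlip (embedXY w) hst ht
    have hproj := congrArg (EuclideanSpace.proj (2 : Fin 3) : ℝ³ →L[ℝ] ℝ) key
    rw [map_sub, ← ContinuousLinearMap.intervalIntegral_comp_comm _ hint] at hproj
    rw [curl2_restrictXY (hdiff t ht _), curl2_restrictXY (hdiff s hs _)]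
    refine (show curl (Ut t) (embedXY w) 2 - curl (Ut s) (embedXY w) 2 = _ from hproj).trans ?_
    refine intervalIntegral.integral_congr fun τ hτ => ?_
    have hτ0 : τ < 0 := by
      rw [uIcc_of_le hst] at hτ; exact lt_of_le_of_lt hτ.2 ht
    exact (vorticity_integrand_restrictXY (hsm τ hτ0) (hinv τ hτ0) (hZ2 τ hτ0) (bt τ) w).symm

/-- **KNSS 2009, Theorem 5.1 from the spatial §4 fact.** Composing with the tree's proof of
Theorem 5.1 from the planar §4 fact (`KNSS2009_liouville_planar_of_regularity`,
`KNSSLiouvillePlanar`: Lemma 2.1 in half-ball form is proved there), the Liouville theorem in the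
plane as printed — a bounded weak solution of Navier–Stokes in `ℝ² × (−∞, 0)` is `u(x, t) = b(t)`
— rests on the single named fact `KNSS2009_regularity_boundedWeak_ancient` (KNSS §4 for `n = 3`),
the same trust base as the tree's Theorems 5.2–5.3. [cite: KochNadirashviliSereginSverak2009, Thm 5.1 (arXiv p. 9)] -/
theorem KNSS2009_liouville_planar_of_ancient (h3 : KNSS2009_regularity_boundedWeak_ancient) :
    KNSS2009_liouville_planar :=
  KNSS2009_liouville_planar_of_regularity (KNSS2009_regularity_boundedWeak_ancient_planar_of_ancient h3)

end Main

end Literature.Analysis.FluidPDE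

end
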